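/-
Copyright (c) 2026 the pub-hodgecm-mathlib formalisation cell (harness21).  Prover seat hodgecm-mathlib-LH4-p06 (g5), Track A «(D-RAM) FOUR-FRAME», unit U2H, census leaf
(ρ2b′-X) `stub_U2H_fixedPointCensus_typeTwo_unit0` — T5c «TORIC LEVEL CENSUS, M∕E-RAMIFIED»: the TOP BIT `χ` of the (D3) row (★ `…RamMTop`, this seat) READ IN ORDER
CURRENCY — the dictionary «`χ` ⟺ `μ ∈ N_{M∕K♮}(U_M)·𝒪_{j+a}`» (F0P3-p01 (g32) T5b v2 letter «`z ∈ N(𝒪_Mˣ)·𝒪_{c′}ˣ`»).  2026-09-04.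
-/
import Summits.HodgeConjecture.HodgeConjecture.Theorems.F0P3cDyRamToricLevelCensusRamMTopPrep  -- ★ p857649 (this seat): brings ★ HEAD p857549 (`v_sub_map_eq_exp_of_datum`), ★ p857372 (`normTwist_mul`, `v_conductorR`, `v_varpiE_pow`), ★ p857519 (`v_twist_add_eq`), ★ DEFS (`IsOrd`)
import HarnessLib

/-!
# T5c: the top bit `χ` of the RamM diagonal cells, in ORDER CURRENCY — `χ ⟺ ∃ ω ∈ U_M, μ·ωΘω ∈ 𝒪_{j+a}`

Cell `hodgecm-mathlib` (D-0151), FLOOR 0, crux H413 = `stmt-HodgeConjecture-24833`; squad F0∕P3c∕LH4; lane `--supports stmt-HodgeConjecture-24833 --as helper` (count-neutral).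
THEOREMS ONLY (no `def`, no instance, no notation, no `sorry`, default heartbeats).  Socket served: payer MAP v2 seam S6-RM ∕ (C0) census top — ★ p857665
`ncard_levelSetDep_top_mul_eq_of_ramified` counts the (D3) top cells of the RamM table as `χ · q^j ∕ [U : B_s]` with the bit
`χ := ∃ ω₁ ∈ U_M, |1 + (η∕κ)·t(ω₁)| ≤ s` (`η = (ρh∕h)·t(α^{k₀})` the class twist, `κ = ρμ∕μ`, `t(x) = ρ(xΘx)∕(xΘx)`, `s = exp(2m − 2a − 2j − d_ρ)`).  THIS FILE reads `χ`:
* §1 twist algebra: `|t(x)| = 1`, `t(x⁻¹) = t(x)⁻¹`, `t(x·y⁻¹) = t(x)∕t(y)`; **`v_one_add_div_mul_eq_of_translator`** — with a translator `η·t₀ = −1` (`|t₀| = |κ| = 1`),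
  `|1 + (η∕κ)·τ| = |κ·t₀ − τ|`; **`v_map_mul_norm_sub_eq`** — `|ρ(μN) − μN| = |μ|·|κ·t − 1|` for `N = ωΘω` (`|ω| = 1`, `t = ρN∕N`).
* §2 **`topBit_iff_exists_twist_add_le`** — the T5a-shaped reading `χ ⟺ ∃ ω₁ ∈ U_M, |κ + η·t(ω₁)| ≤ s` («`−κ` lies within `s` of the coset `η·ψ(N_Θ(U_M))` of the twists of
  the `K♮`-unit norms»; no translator needed), and, GIVEN an exact unit translator `hη : η·t(ω₀) = −1` (★ HEAD's hypothesis, g32's «membership rows»),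
  **`topBit_iff_exists_isOrd_of_translator`** — `χ ⟺ ∃ ω ∈ U_M, IsOrd ρ α (ϖE^{j+a}) (μ·ωΘω)`: the bit is `h`-FREE and `k₀`-FREE, it says exactly «`μ` is a unit norm
  from `M` to `K♮` away from the order `𝒪_{j+a} = 𝒪_E + ϖE^{j+a}𝒪_M`» — F0P3-p01 (g32)'s T5b v2 letter «`z ∈ N_{M∕K♮}(𝒪_Mˣ)·𝒪_{c′}ˣ`» (`z = μϖE^{−m}`, `c′ = j + a − m`)
  in the ★ DEFS currency `IsOrd`; the side × ε asymmetry of the sign cells (memo §5) therefore sits entirely in WHICH coset `−η·ψ(N_Θ(U_M))` the side's class selects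
  (translator rows), not in the depth count.
* §3 (ED. 2, append-only) **`topBit_iff_exists_isOrd_of_anchor`** — the same dictionary for a class pinned by an ANCHOR `η·t(ω₀)·(ρn₀∕n₀) = −1` (`n₀` any unit scalar; for
  the RamM `−` side `n₀` = a `Θ`-fixed unit non-norm, LH4-p04 (g4)'s class E): `χ ⟺ ∃ ω ∈ U_M, IsOrd ρ α (ϖE^{j+a}) (μ·n₀·ωΘω)` («`μ·n₀ ∈ N_{M∕K♮}(U_M)·𝒪_{j+a}`»).
HONEST LABEL.  Count-neutral (`--supports`); unconditional algebra; the closed-form sign law of `χ` (the RamM twin of LH4-p08's (R1-TOP-SIDE)) is NOT asserted here —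
`HC_CM` is proved only modulo the 7 printed citations (2 remaining named inputs: hLiu418 = `stmt-HodgeConjecture-24832`, h413 = `stmt-HodgeConjecture-24833`) until rung 0
closes.

## References
* [Jacobowitz1962] R. Jacobowitz, *Hermitian forms over local fields*, Amer. J. Math. 84 (1962): §4 (norm classes of hermitian lattices).
* [Serre1979] J.-P. Serre, *Local Fields*, GTM 67 (1979): Ch. V §1, §3 (unit norm subgroups).
* [Kottwitz1986BaseChangeUnits] R. E. Kottwitz, *Base change for unit elements of Hecke algebras*, Compositio Math. 60 (1986): §1 pp. 240–241 (the tube ∕ depth condition).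
* [Flicker1998UnitaryFL] Y. Z. Flicker, *Elementary proof of the fundamental lemma for a unitary group*, Canad. J. Math. 50 (1998): p. 84 (the orders `R_E(j)`).
-/

set_option autoImplicit false

noncomputable section

namespace Summit.HodgeConjecture.HodgeConjecture.Cruxes.H413.F0P3cDyRamToricLevelCensusRamM

open WithZero
open scoped Valued
open Literature.NumberTheory.Automorphic.UnitaryThreeFourFrame (IsRamifiedQuadraticDatum)
open Literature.NumberTheory.LocalFields.QuadraticOrder
open Summit.HodgeConjecture.HodgeConjecture.Cruxes.H413.F0P3cDyRamToricCensusDefs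
open Summit.HodgeConjecture.HodgeConjecture.Cruxes.H413.F0P3cDyRamToricLevelCensusUnr (v_twist_add_eq)

variable {K : Type} [Field K] [Valued K ℤᵐ⁰] {ρ Θ : K →+* K} {α ϖE : K} {dρ t : ℕ}

/-! ## §1 Twist algebra -/

/-- **`|t(x)| = 1`** for `x ≠ 0` (`t(x) = ρ(xΘx)∕(xΘx)`, `ρ` isometric). [cite: Serre1979, Ch. V §1] -/
theorem v_normTwist_eq_one (hvρ : ∀ x, Valued.v (ρ x) = Valued.v x) {x : K} (hx : x ≠ 0) :
    Valued.v (ρ (x * Θ x) / (x * Θ x)) = 1 := by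
  rw [map_div₀, hvρ, div_self ((Valuation.ne_zero_iff _).2 (mul_ne_zero hx ((map_ne_zero Θ).2 hx)))]

omit [Valued K ℤᵐ⁰] in
/-- **`t(x⁻¹) = t(x)⁻¹`** (`N(x⁻¹) = N(x)⁻¹`). [cite: Jacobowitz1962, §4] -/
theorem normTwist_inv (x : K) : ρ (x⁻¹ * Θ x⁻¹) / (x⁻¹ * Θ x⁻¹) = (ρ (x * Θ x) / (x * Θ x))⁻¹ := by
  rw [map_inv₀, ← mul_inv, map_inv₀, inv_div_inv, inv_div]

omit [Valued K ℤᵐ⁰] in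
/-- **`t(x·y⁻¹) = t(x)∕t(y)`** for `x, y ≠ 0` (★ `normTwist_mul` + `normTwist_inv`). [cite: Jacobowitz1962, §4] -/
theorem normTwist_mul_inv {x y : K} (hx : x ≠ 0) (hy : y ≠ 0) :
    ρ (x * y⁻¹ * Θ (x * y⁻¹)) / (x * y⁻¹ * Θ (x * y⁻¹)) = (ρ (x * Θ x) / (x * Θ x)) / (ρ (y * Θ y) / (y * Θ y)) := by
  rw [normTwist_mul hx (inv_ne_zero hy), normTwist_inv]
  exact (div_eq_mul_inv _ _).symm

/-- **TRANSLATOR ALGEBRA**: with `η·t₀ = −1` and `|κ| = |t₀| = 1`, `|1 + (η∕κ)·τ| = |κ·t₀ − τ|` (`1 + (η∕κ)τ = (κt₀ − τ)∕(κt₀)`). [cite: Jacobowitz1962, §4] -/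
theorem v_one_add_div_mul_eq_of_translator {η κ t₀ τ : K} (hη : η * t₀ = -1) (hκ : Valued.v κ = 1) (ht₀ : Valued.v t₀ = 1) :
    Valued.v (1 + η / κ * τ) = Valued.v (κ * t₀ - τ) := by
  have hκ0 : κ ≠ 0 := fun h0 => by rw [h0, map_zero] at hκ; exact zero_ne_one hκ
  have ht0 : t₀ ≠ 0 := fun h0 => by rw [h0, map_zero] at ht₀; exact zero_ne_one ht₀
  have hηeq : η = -1 / t₀ := by rw [eq_div_iff ht0]; exact hη
  have hre : 1 + η / κ * τ = (κ * t₀ - τ) / (κ * t₀) := by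
    rw [hηeq]; field_simp; ring
  rw [hre, map_div₀, map_mul, hκ, ht₀, mul_one, div_one]

/-- **THE `ρ`-DEPTH OF `μ·N(ω)`**: `|ρ(μN) − μN| = |μ|·|κ·t − 1|` for `N = ωΘω`, `|ω| = 1`, `κ = ρμ∕μ`, `t = ρN∕N` (`ρ(μN) = κt·μN`). [cite: Serre1979, Ch. V §3] -/
theorem v_map_mul_norm_sub_eq (hvΘ : ∀ x, Valued.v (Θ x) = Valued.v x) {μ : K} (hμ0 : μ ≠ 0) {ω : K} (hω : Valued.v ω = 1) :
    Valued.v (ρ (μ * (ω * Θ ω)) - μ * (ω * Θ ω)) = Valued.v μ * Valued.v (ρ μ / μ * (ρ (ω * Θ ω) / (ω * Θ ω)) - 1) := by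
  have hω0 : ω ≠ 0 := fun h0 => by rw [h0, map_zero] at hω; exact zero_ne_one hω
  have hN0 : ω * Θ ω ≠ 0 := mul_ne_zero hω0 ((map_ne_zero Θ).2 hω0)
  have hΘω0 : Θ ω ≠ 0 := (map_ne_zero Θ).2 hω0
  have hvN : Valued.v (ω * Θ ω) = 1 := by rw [map_mul, hvΘ, hω, mul_one]
  have hre : ρ (μ * (ω * Θ ω)) - μ * (ω * Θ ω) = μ * (ω * Θ ω) * (ρ μ / μ * (ρ (ω * Θ ω) / (ω * Θ ω)) - 1) := by
    rw [map_mul]; field_simp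
  rw [hre, map_mul, map_mul, hvN, mul_one]

/-! ## §2 The bit in coset currency and in order currency -/

/-- **THE BIT, COSET FORM (no translator needed)**: `(∃ ω₁ ∈ U_M, |1 + (η∕κ)·t(ω₁)| ≤ s) ⟺ (∃ ω₁ ∈ U_M, |κ + η·t(ω₁)| ≤ s)` for `κ = ρμ∕μ` (`|κ| = 1`; ★ `v_twist_add_eq`) —
«`−κ` lies within `s` of the coset `η·ψ(N_Θ(U_M))`», the RamM reading of LH4-p08 (g4)'s T5a bit `|(ρh∕h)(ρN∕N) + ρμ∕μ| ≤ r`. [cite: Jacobowitz1962, §4] [cite: Serre1979, Ch. V §3] -/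
theorem topBit_iff_exists_twist_add_le (hvρ : ∀ x, Valued.v (ρ x) = Valued.v x) {μ : K} (hμ0 : μ ≠ 0) (η : K) (s : ℤᵐ⁰) :
    (∃ ω₁ : Kˣ, Valued.v (ω₁ : K) = 1 ∧ Valued.v (1 + η / (ρ μ / μ) * (ρ ((ω₁ : K) * Θ ω₁) / ((ω₁ : K) * Θ ω₁))) ≤ s) ↔
      ∃ ω₁ : Kˣ, Valued.v (ω₁ : K) = 1 ∧ Valued.v (ρ μ / μ + η * (ρ ((ω₁ : K) * Θ ω₁) / ((ω₁ : K) * Θ ω₁))) ≤ s := by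
  have hκ : Valued.v (ρ μ / μ) = 1 := by rw [map_div₀, hvρ, div_self ((Valuation.ne_zero_iff _).2 hμ0)]
  refine exists_congr (fun ω₁ => and_congr_right (fun _ => ?_))
  rw [← v_twist_add_eq η _ hκ, add_comm]

/-- **THE BIT IN ORDER CURRENCY (given an exact unit translator).**  In the ramified frame (`(M, ρ, α, d_ρ)` a ramified datum, `Θ` isometric, `|ϖE| = exp(−2)`, `|μ| = |ϖE|^m`),
if `η·t(ω₀) = −1` for a unit `ω₀` (★ HEAD's translator hypothesis) then
**`(∃ ω₁ ∈ U_M, |1 + (η∕κ)·t(ω₁)| ≤ exp(2m − 2a − 2j − d_ρ)) ⟺ (∃ ω ∈ U_M, IsOrd ρ α (ϖE^{j+a}) (μ·ωΘω))`** — the top bit says exactly that `μ` is a unit norm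
`N_{M∕K♮}(ω)` away from the order `𝒪_{j+a}`; it is free of `h`, of the class exponent `k₀` and of the translator (`ω ↔ ω₀·ω₁⁻¹`; `|ρ(μN) − μN| = |μ|·|κt − 1|`,
`|μ|·exp(2m − 2a − 2j − d_ρ) = |ϖE^{j+a}(α − ρα)|`).  This is F0P3-p01 (g32)'s T5b v2 letter «`z ∈ N_{M∕K♮}(𝒪_Mˣ)·𝒪_{c′}ˣ`» (`z = μϖE^{−m}`, `c′ = j + a − m`).
[cite: Jacobowitz1962, §4] [cite: Flicker1998UnitaryFL, p. 84] [cite: Kottwitz1986BaseChangeUnits, §1 pp. 240–241] -/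
theorem topBit_iff_exists_isOrd_of_translator (hD : IsRamifiedQuadraticDatum ρ α dρ t) (hvΘ : ∀ x, Valued.v (Θ x) = Valued.v x)
    (hϖE : Valued.v ϖE = exp (-2 : ℤ)) {η : K} {ω₀ : Kˣ} (hω₀ : Valued.v (ω₀ : K) = 1)
    (hη : η * (ρ ((ω₀ : K) * Θ ω₀) / ((ω₀ : K) * Θ ω₀)) = -1) {μ : K} {m : ℕ} (hμ : Valued.v μ = Valued.v ϖE ^ m) (j a : ℕ) :
    (∃ ω₁ : Kˣ, Valued.v (ω₁ : K) = 1 ∧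
        Valued.v (1 + η / (ρ μ / μ) * (ρ ((ω₁ : K) * Θ ω₁) / ((ω₁ : K) * Θ ω₁))) ≤ exp (2 * (m : ℤ) - 2 * a - 2 * j - dρ)) ↔
      ∃ ω : Kˣ, Valued.v (ω : K) = 1 ∧ IsOrd ρ α (ϖE ^ (j + a)) (μ * ((ω : K) * Θ ω)) := by
  obtain ⟨-, hvρ, -, -, -, -, -⟩ := id hD
  have hδ := v_sub_map_eq_exp_of_datum hD
  have hμ0 : μ ≠ 0 := fun h0 => by
    rw [h0, map_zero, v_varpiE_pow hϖE] at hμ; exact exp_ne_zero hμ.symm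
  have hvμ0 : 0 < Valued.v μ := zero_lt_iff.2 ((Valuation.ne_zero_iff _).2 hμ0)
  have hκ : Valued.v (ρ μ / μ) = 1 := by rw [map_div₀, hvρ, div_self ((Valuation.ne_zero_iff _).2 hμ0)]
  have ht₀ : Valued.v (ρ ((ω₀ : K) * Θ ω₀) / ((ω₀ : K) * Θ ω₀)) = 1 := v_normTwist_eq_one hvρ ω₀.ne_zero
  -- the two radii: `|ϖE^{j+a}(α − ρα)| = |μ|·exp(2m − 2a − 2j − d_ρ)`
  have hcond : Valued.v (ϖE ^ (j + a) * (α - ρ α)) = Valued.v μ * exp (2 * (m : ℤ) - 2 * a - 2 * j - dρ) := by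
    rw [v_conductorR (ρ := ρ) hδ hϖE (j + a), hμ, v_varpiE_pow hϖE, ← exp_add]
    congr 1; push_cast; ring
  -- `IsOrd` for `y = μ·N(ω)` is `|κ·t(ω) − 1| ≤ s`
  have hIsOrd : ∀ ω : Kˣ, Valued.v (ω : K) = 1 →
      (IsOrd ρ α (ϖE ^ (j + a)) (μ * ((ω : K) * Θ ω)) ↔
        Valued.v (ρ μ / μ * (ρ ((ω : K) * Θ ω) / ((ω : K) * Θ ω)) - 1) ≤ exp (2 * (m : ℤ) - 2 * a - 2 * j - dρ)) := by
    intro ω hω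
    have hint : Valued.v (μ * ((ω : K) * Θ ω)) ≤ 1 := by
      rw [map_mul, map_mul, hvΘ, hω, mul_one, mul_one, hμ, v_varpiE_pow hϖE, ← exp_zero, exp_le_exp]; omega
    rw [IsOrd, Valuation.map_sub_swap, v_map_mul_norm_sub_eq hvΘ hμ0 hω, hcond]
    constructor
    · rintro ⟨-, hle⟩
      exact le_of_mul_le_mul_left hle hvμ0
    · intro hle
      exact ⟨hint, mul_le_mul_right hle _⟩
  constructor
  · rintro ⟨ω₁, hω₁, hle⟩
    rw [v_one_add_div_mul_eq_of_translator hη hκ ht₀] at hle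
    have hω : Valued.v ((ω₀ * ω₁⁻¹ : Kˣ) : K) = 1 := by
      rw [Units.val_mul, Units.val_inv_eq_inv_val, map_mul, map_inv₀, hω₀, hω₁, inv_one, mul_one]
    refine ⟨ω₀ * ω₁⁻¹, hω, (hIsOrd _ hω).2 ?_⟩
    have ht₁ : Valued.v (ρ ((ω₁ : K) * Θ ω₁) / ((ω₁ : K) * Θ ω₁)) = 1 := v_normTwist_eq_one hvρ ω₁.ne_zero
    have ht₁0 : ρ ((ω₁ : K) * Θ ω₁) / ((ω₁ : K) * Θ ω₁) ≠ 0 := fun h0 => by rw [h0, map_zero] at ht₁; exact zero_ne_one ht₁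
    have htw : ρ (((ω₀ * ω₁⁻¹ : Kˣ) : K) * Θ ((ω₀ * ω₁⁻¹ : Kˣ) : K)) / (((ω₀ * ω₁⁻¹ : Kˣ) : K) * Θ ((ω₀ * ω₁⁻¹ : Kˣ) : K)) =
        (ρ ((ω₀ : K) * Θ ω₀) / ((ω₀ : K) * Θ ω₀)) / (ρ ((ω₁ : K) * Θ ω₁) / ((ω₁ : K) * Θ ω₁)) := by
      rw [Units.val_mul, Units.val_inv_eq_inv_val]; exact normTwist_mul_inv ω₀.ne_zero ω₁.ne_zero
    have hre : ρ μ / μ * ((ρ ((ω₀ : K) * Θ ω₀) / ((ω₀ : K) * Θ ω₀)) / (ρ ((ω₁ : K) * Θ ω₁) / ((ω₁ : K) * Θ ω₁))) - 1 =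
        (ρ μ / μ * (ρ ((ω₀ : K) * Θ ω₀) / ((ω₀ : K) * Θ ω₀)) - ρ ((ω₁ : K) * Θ ω₁) / ((ω₁ : K) * Θ ω₁)) /
          (ρ ((ω₁ : K) * Θ ω₁) / ((ω₁ : K) * Θ ω₁)) := by
      field_simp
    rw [htw, hre, map_div₀, ht₁, div_one]
    exact hle
  · rintro ⟨ω, hω, hord⟩
    have hle := (hIsOrd ω hω).1 hord
    have hω₁ : Valued.v ((ω⁻¹ * ω₀ : Kˣ) : K) = 1 := by
      rw [Units.val_mul, Units.val_inv_eq_inv_val, map_mul, map_inv₀, hω₀, hω, inv_one, mul_one]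
    refine ⟨ω⁻¹ * ω₀, hω₁, ?_⟩
    rw [v_one_add_div_mul_eq_of_translator hη hκ ht₀]
    have htω : Valued.v (ρ ((ω : K) * Θ ω) / ((ω : K) * Θ ω)) = 1 := v_normTwist_eq_one hvρ ω.ne_zero
    have htω0 : ρ ((ω : K) * Θ ω) / ((ω : K) * Θ ω) ≠ 0 := fun h0 => by rw [h0, map_zero] at htω; exact zero_ne_one htω
    have htw : ρ (((ω⁻¹ * ω₀ : Kˣ) : K) * Θ ((ω⁻¹ * ω₀ : Kˣ) : K)) / (((ω⁻¹ * ω₀ : Kˣ) : K) * Θ ((ω⁻¹ * ω₀ : Kˣ) : K)) =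
        (ρ ((ω₀ : K) * Θ ω₀) / ((ω₀ : K) * Θ ω₀)) / (ρ ((ω : K) * Θ ω) / ((ω : K) * Θ ω)) := by
      rw [Units.val_mul, Units.val_inv_eq_inv_val, mul_comm ((ω : K)⁻¹) (ω₀ : K)]; exact normTwist_mul_inv ω₀.ne_zero ω.ne_zero
    have hre : ρ μ / μ * (ρ ((ω₀ : K) * Θ ω₀) / ((ω₀ : K) * Θ ω₀)) -
          (ρ ((ω₀ : K) * Θ ω₀) / ((ω₀ : K) * Θ ω₀)) / (ρ ((ω : K) * Θ ω) / ((ω : K) * Θ ω)) =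
        (ρ ((ω₀ : K) * Θ ω₀) / ((ω₀ : K) * Θ ω₀)) * (ρ μ / μ * (ρ ((ω : K) * Θ ω) / ((ω : K) * Θ ω)) - 1) /
          (ρ ((ω : K) * Θ ω) / ((ω : K) * Θ ω)) := by
      field_simp
    rw [htw, hre, map_div₀, map_mul, ht₀, htω, one_mul, div_one]
    exact hle

/-! ## §3 (ED. 2) The ANCHORED bit: classes without an exact unit translator -/

/-- **THE BIT IN ORDER CURRENCY, ANCHORED FORM (no exact unit translator needed).**  If the class twist `η` is pinned by an ANCHOR `η·t(ω₀)·(ρn₀∕n₀) = −1` with a unit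
`ω₀` and a unit scalar `n₀` (for the RamM `−` side: `n₀` a `Θ`-fixed unit NON-norm, the non-norm even class E of LH4-p04 (g4)'s class model; `n₀ = 1` is ★ §2), then
**`(∃ ω₁ ∈ U_M, |1 + (η∕κ)·t(ω₁)| ≤ exp(2m − 2a − 2j − d_ρ)) ⟺ (∃ ω ∈ U_M, IsOrd ρ α (ϖE^{j+a}) (μ·n₀·ωΘω))`** — «`μ·n₀ ∈ N_{M∕K♮}(U_M)·𝒪_{j+a}`»
(★ §2 applied to `μ′ = μ·n₀`, `η′ = η·(ρn₀∕n₀)`: `ρμ′∕μ′ = κ·ρn₀∕n₀`, so `η′∕(ρμ′∕μ′) = η∕κ`). [cite: Jacobowitz1962, §4] [cite: Flicker1998UnitaryFL, p. 84] [cite: Kottwitz1986BaseChangeUnits, §1 pp. 240–241] -/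
theorem topBit_iff_exists_isOrd_of_anchor (hD : IsRamifiedQuadraticDatum ρ α dρ t) (hvΘ : ∀ x, Valued.v (Θ x) = Valued.v x)
    (hϖE : Valued.v ϖE = exp (-2 : ℤ)) {η n₀ : K} {ω₀ : Kˣ} (hω₀ : Valued.v (ω₀ : K) = 1) (hn₀ : Valued.v n₀ = 1)
    (hη : η * (ρ ((ω₀ : K) * Θ ω₀) / ((ω₀ : K) * Θ ω₀)) * (ρ n₀ / n₀) = -1) {μ : K} {m : ℕ} (hμ : Valued.v μ = Valued.v ϖE ^ m) (j a : ℕ) :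
    (∃ ω₁ : Kˣ, Valued.v (ω₁ : K) = 1 ∧
        Valued.v (1 + η / (ρ μ / μ) * (ρ ((ω₁ : K) * Θ ω₁) / ((ω₁ : K) * Θ ω₁))) ≤ exp (2 * (m : ℤ) - 2 * a - 2 * j - dρ)) ↔
      ∃ ω : Kˣ, Valued.v (ω : K) = 1 ∧ IsOrd ρ α (ϖE ^ (j + a)) (μ * n₀ * ((ω : K) * Θ ω)) := by
  have hn₀0 : n₀ ≠ 0 := fun h0 => by rw [h0, map_zero] at hn₀; exact zero_ne_one hn₀
  have hρn₀0 : ρ n₀ ≠ 0 := (map_ne_zero ρ).2 hn₀0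
  have hμ0 : μ ≠ 0 := fun h0 => by
    rw [h0, map_zero, v_varpiE_pow hϖE] at hμ; exact exp_ne_zero hμ.symm
  have hρμ0 : ρ μ ≠ 0 := (map_ne_zero ρ).2 hμ0
  have hμ' : Valued.v (μ * n₀) = Valued.v ϖE ^ m := by rw [map_mul, hn₀, mul_one, hμ]
  have hη' : η * (ρ n₀ / n₀) * (ρ ((ω₀ : K) * Θ ω₀) / ((ω₀ : K) * Θ ω₀)) = -1 := by rw [mul_right_comm]; exact hη
  rw [← topBit_iff_exists_isOrd_of_translator hD hvΘ hϖE hω₀ hη' hμ' j a]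
  refine exists_congr (fun ω₁ => and_congr_right (fun _ => ?_))
  have hsc : η / (ρ μ / μ) = η * (ρ n₀ / n₀) / (ρ (μ * n₀) / (μ * n₀)) := by
    rw [map_mul]; field_simp
  rw [hsc]

end Summit.HodgeConjecture.HodgeConjecture.Cruxes.H413.F0P3cDyRamToricLevelCensusRamM

end
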